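import Mathlib
import Summits.AtomisticToContinuum.HydrodynamicLimit.Theorems.ImplosionDichotomyDenseExcursionConeDefs

/-!
# Rotation covariance of the chart-level athermal Euler system — stub `stub_rotationCovariance` (L2)

Crux `Summit.AtomisticToContinuum.HydrodynamicLimit.Theses.ImplosionDichotomy.DenseExcursion`
(stmt-AtomisticToContinuum-12586), line `r2-one-mode-two-conditions` (skeleton v8), registered stub
`stub_rotationCovariance : ChartRotationCovariance` over the landed chart system `AthermalEulerAt` of
`…Theorems.KidderKnobMelnikov` (`…ConeDefs.lean`).

**Mathematics.** For a linear isometry equivalence `Q` of `V3 = ℝ³` and curried fields `P, Θ : ℝ → V3 → ℝ`,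
`U : ℝ → V3 → V3`, the rotated fields `(P ∘ Q, Θ ∘ Q, Q⁻¹ ∘ U ∘ Q)` solve the primitive athermal Euler system
`AthermalEulerAt ζ` at `(t, x)` iff `(P, Θ, U)` solve it at `(t, Q x)`, for EVERY law `ζ` and with NO regularity
hypothesis: Mathlib's `fderiv`, `gradient`, `deriv` junk values (`0` at points of non-differentiability) are
preserved by composition with a continuous linear equivalence on either side
(`ContinuousLinearEquiv.comp_right_fderiv`, `LinearIsometryEquiv.comp_fderiv`, both unconditional), so the
identities
* `fderiv (f ∘ Q) x v = fderiv f (Q x) (Q v)`, `fderiv (Q⁻¹ ∘ W ∘ Q) x v = Q⁻¹ (fderiv W (Q x) (Q v))`,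
* `∇(f ∘ Q) x = Q⁻¹ (∇f (Q x))` (the adjoint of a linear isometry equivalence is its inverse),
* `deriv (Q⁻¹ ∘ g) t = Q⁻¹ (deriv g t)`,
* `div (Q⁻¹ ∘ W ∘ Q) x = div W (Q x)` (the divergence `∑ᵢ (∂ᵢW)ᵢ` is the trace of `fderiv W`, and the trace is the
  same in the orthonormal bases `eᵢ` and `Q eᵢ`, `LinearMap.trace_eq_sum_inner`)
hold pointwise everywhere. Substituting, the continuity and temperature equations of the rotated fields at `x` are
literally those of the original fields at `Q x`, and the momentum equation is `Q⁻¹` applied to the original one,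
equivalent to it by injectivity. Folklore (isotropy of the Euler equations of an inviscid fluid); no cited facts.
-/

noncomputable section

open Set Filter Topology
open scoped ContDiff

namespace Summit.AtomisticToContinuum.HydrodynamicLimit.Theorems.R2OneModeTwoConditions

open Literature.MathematicalPhysics.KineticTheory
open Literature.Analysis.FunctionSpaces
open Summit.AtomisticToContinuum.HydrodynamicLimit.Theorems.KidderKnobMelnikov (AthermalEulerAt HsEulerConeLocality)

/-! ## The statement (verbatim: skeleton §0d) -/

/-- ROTATION COVARIANCE of the chart system: for a linear isometry `Q` of `ℝ³`, the rotated fields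
`(P ∘ Q, Θ ∘ Q, Q⁻¹ ∘ U ∘ Q)` solve `AthermalEulerAt ζ` at `(t, x)` iff `(P, Θ, U)` do at `(t, Q x)` (every law `ζ`;
unconditional — `fderiv`/`gradient`/`deriv` junk values are preserved by composition with a linear isometry, Mathlib
`ContinuousLinearEquiv.comp_right_fderiv`). With `stub_shrinkingBallLocality` it makes the core development of radial
chart data radial, so that the heart's bootstrap runs on the reduced system `RadialReductionD`. -/
def ChartRotationCovariance : Prop :=
  ∀ (ζ : ℝ → ℝ) (P Θ : ℝ → V3 → ℝ) (U : ℝ → V3 → V3) (Q : V3 ≃ₗᵢ[ℝ] V3) (t : ℝ) (x : V3),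
    AthermalEulerAt ζ (fun s y => P s (Q y)) (fun s y => Θ s (Q y)) (fun s y => Q.symm (U s (Q y))) t x ↔
      AthermalEulerAt ζ P Θ U t (Q x)

/-! ## Calculus through a linear isometry equivalence of `ℝ³` (unconditional pointwise identities) -/

/-- Time derivative through a linear isometry equivalence `L` of `ℝ³`: `deriv (L ∘ g) t = L (deriv g t)` for EVERY
`g : ℝ → ℝ³` (no differentiability needed: `deriv = fderiv · 1` and `LinearIsometryEquiv.comp_fderiv` is
unconditional, the junk value `0` being mapped to `0`). [folklore] -/
theorem deriv_linearIsometryEquiv_comp_apply (L : V3 ≃ₗᵢ[ℝ] V3) (g : ℝ → V3) (t : ℝ) :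
    deriv (fun s => L (g s)) t = L (deriv g t) := by
  show fderiv ℝ (L ∘ g) t 1 = L (fderiv ℝ g t 1)
  rw [L.comp_fderiv]
  rfl

/-- Chain rule on the right with a linear isometry equivalence `L` of `ℝ³`, unconditionally:
`fderiv (f ∘ L) x v = fderiv f (L x) (L v)` for EVERY `f : ℝ³ → F` (Mathlib `ContinuousLinearEquiv.comp_right_fderiv`:
`f ∘ L` is differentiable at `x` iff `f` is at `L x`, so junk values correspond). [folklore] -/
theorem fderiv_comp_linearIsometryEquiv_apply {F : Type*} [NormedAddCommGroup F] [NormedSpace ℝ F]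
    (L : V3 ≃ₗᵢ[ℝ] V3) (f : V3 → F) (x v : V3) :
    fderiv ℝ (fun y => f (L y)) x v = fderiv ℝ f (L x) (L v) := by
  have h : (fun y => f (L y)) = f ∘ (L : V3 ≃L[ℝ] V3) := rfl
  rw [h, (L : V3 ≃L[ℝ] V3).comp_right_fderiv]
  rfl

/-- Derivative of a conjugated vector field: `fderiv (L⁻¹ ∘ W ∘ L) x v = L⁻¹ (fderiv W (L x) (L v))` for EVERY
`W : ℝ³ → ℝ³` and every linear isometry equivalence `L` (both one-sided composition rules are unconditional). [folklore] -/
theorem fderiv_conj_linearIsometryEquiv_apply (L : V3 ≃ₗᵢ[ℝ] V3) (W : V3 → V3) (x v : V3) :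
    fderiv ℝ (fun y => L.symm (W (L y))) x v = L.symm (fderiv ℝ W (L x) (L v)) := by
  have h : (fun y => L.symm (W (L y))) = L.symm ∘ (fun y => W (L y)) := rfl
  rw [h, L.symm.comp_fderiv, ContinuousLinearMap.comp_apply, fderiv_comp_linearIsometryEquiv_apply]
  rfl

/-- Gradient through a linear isometry equivalence: `∇(f ∘ L) x = L⁻¹ (∇f (L x))` for EVERY `f : ℝ³ → ℝ` (the adjoint
of a linear isometry equivalence is its inverse, `LinearIsometryEquiv.inner_map_map`; `gradient = toDual⁻¹ ∘ fderiv`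
so the unconditional chain rule transfers). [folklore] -/
theorem gradient_comp_linearIsometryEquiv (L : V3 ≃ₗᵢ[ℝ] V3) (f : V3 → ℝ) (x : V3) :
    gradient (fun y => f (L y)) x = L.symm (gradient f (L x)) := by
  refine ext_inner_right ℝ fun v => ?_
  rw [inner_gradient_left, fderiv_comp_linearIsometryEquiv_apply, ← L.inner_map_map, L.apply_symm_apply,
    inner_gradient_left]

/-- The divergence `∑ᵢ (A eᵢ)ᵢ` (`eᵢ = EuclideanSpace.single i 1`) of a continuous linear map `A` of `ℝ³` is
invariant under conjugation by a linear isometry equivalence `L`: `∑ᵢ (L⁻¹ A L eᵢ)ᵢ = ∑ᵢ (A eᵢ)ᵢ`. Both sides are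
the trace of `A`, computed in the orthonormal bases `(L eᵢ)` and `(eᵢ)` (`LinearMap.trace_eq_sum_inner`,
`(v)ᵢ = ⟪eᵢ, v⟫`, `⟪eᵢ, L⁻¹ w⟫ = ⟪L eᵢ, w⟫`). [folklore] -/
theorem divergence_conj_linearIsometryEquiv (L : V3 ≃ₗᵢ[ℝ] V3) (A : V3 →L[ℝ] V3) :
    ∑ i, (L.symm (A (L (EuclideanSpace.single i 1)))) i = ∑ i, (A (EuclideanSpace.single i 1)) i := by
  have h1 : LinearMap.trace ℝ V3 (A : V3 →ₗ[ℝ] V3) = ∑ i, (A (EuclideanSpace.single i 1)) i := by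
    rw [LinearMap.trace_eq_sum_inner (A : V3 →ₗ[ℝ] V3) (EuclideanSpace.basisFun (Fin 3) ℝ)]
    refine Finset.sum_congr rfl fun i _ => ?_
    rw [EuclideanSpace.basisFun_apply, ContinuousLinearMap.coe_coe, EuclideanSpace.inner_single_left, map_one,
      one_mul]
  have h2 : LinearMap.trace ℝ V3 (A : V3 →ₗ[ℝ] V3) = ∑ i, (L.symm (A (L (EuclideanSpace.single i 1)))) i := by
    rw [LinearMap.trace_eq_sum_inner (A : V3 →ₗ[ℝ] V3) ((EuclideanSpace.basisFun (Fin 3) ℝ).map L)]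
    refine Finset.sum_congr rfl fun i _ => ?_
    rw [OrthonormalBasis.map_apply, EuclideanSpace.basisFun_apply, ContinuousLinearMap.coe_coe,
      LinearIsometryEquiv.inner_map_eq_flip, EuclideanSpace.inner_single_left, map_one, one_mul]
  rw [← h1, ← h2]

/-- Linear-algebra form of the momentum equation's covariance: for a linear isometry equivalence `L`,
`p • (L a + L b) + c₁ • L g₁ + c₂ • L g₂ = 0 ↔ p • (a + b) + c₁ • g₁ + c₂ • g₂ = 0` (linearity and injectivity
of `L`). [folklore] -/
theorem smul_add_linearIsometryEquiv_eq_zero_iff (L : V3 ≃ₗᵢ[ℝ] V3) (p c₁ c₂ : ℝ) (a b g₁ g₂ : V3) :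
    p • (L a + L b) + c₁ • L g₁ + c₂ • L g₂ = 0 ↔ p • (a + b) + c₁ • g₁ + c₂ • g₂ = 0 := by
  rw [← L.map_add, ← LinearIsometryEquiv.map_smul, ← LinearIsometryEquiv.map_smul,
    ← LinearIsometryEquiv.map_smul, ← L.map_add, ← L.map_add, L.map_eq_zero_iff]

/-! ## Rotation covariance (stub L2) -/

/-- **ROTATION COVARIANCE** of the chart-level athermal Euler system (stub L2 of line `r2-one-mode-two-conditions`):
for every law `ζ`, all curried fields `P, Θ : ℝ → ℝ³ → ℝ`, `U : ℝ → ℝ³ → ℝ³`, every linear isometry equivalence `Q`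
of `ℝ³` and every `(t, x)`, the rotated fields `(P ∘ Q, Θ ∘ Q, Q⁻¹ ∘ U ∘ Q)` satisfy `AthermalEulerAt ζ` at `(t, x)`
iff `(P, Θ, U)` satisfy it at `(t, Q x)`. Unconditional: every `deriv`/`fderiv`/`gradient`/divergence of the rotated
fields at `x` is the corresponding one of the original fields at `Q x`, transported by `Q⁻¹` where vector-valued
(lemmas above); the two scalar equations then coincide literally and the momentum equation is `Q⁻¹` of the original
one. [folklore] -/
theorem stub_rotationCovariance : ChartRotationCovariance := by
  intro ζ P Θ U Q t x
  -- the pointwise transport identities for the fields at hand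
  have hP : ∀ v, fderiv ℝ (fun y => P t (Q y)) x v = fderiv ℝ (P t) (Q x) (Q v) :=
    fderiv_comp_linearIsometryEquiv_apply Q (P t) x
  have hΘ : ∀ v, fderiv ℝ (fun y => Θ t (Q y)) x v = fderiv ℝ (Θ t) (Q x) (Q v) :=
    fderiv_comp_linearIsometryEquiv_apply Q (Θ t) x
  have hU : ∀ v, fderiv ℝ (fun y => Q.symm (U t (Q y))) x v = Q.symm (fderiv ℝ (U t) (Q x) (Q v)) :=
    fderiv_conj_linearIsometryEquiv_apply Q (U t) x
  have hUt : deriv (fun s => Q.symm (U s (Q x))) t = Q.symm (deriv (fun s => U s (Q x)) t) :=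
    deriv_linearIsometryEquiv_comp_apply Q.symm (fun s => U s (Q x)) t
  have hgP : gradient (fun y => P t (Q y)) x = Q.symm (gradient (P t) (Q x)) :=
    gradient_comp_linearIsometryEquiv Q (P t) x
  have hgΘ : gradient (fun y => Θ t (Q y)) x = Q.symm (gradient (Θ t) (Q x)) :=
    gradient_comp_linearIsometryEquiv Q (Θ t) x
  have hdiv : ∑ i, (Q.symm (fderiv ℝ (U t) (Q x) (Q (EuclideanSpace.single i 1)))) i =
      ∑ i, (fderiv ℝ (U t) (Q x) (EuclideanSpace.single i 1)) i :=
    divergence_conj_linearIsometryEquiv Q (fderiv ℝ (U t) (Q x))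
  simp only [AthermalEulerAt, hP, hΘ, hU, hUt, hgP, hgΘ, hdiv, Q.apply_symm_apply]
  -- the momentum equation of the rotated fields is `Q⁻¹` of the original one
  rw [smul_add_linearIsometryEquiv_eq_zero_iff]

end Summit.AtomisticToContinuum.HydrodynamicLimit.Theorems.R2OneModeTwoConditions

end
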